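import Summits.ValiantsHypothesis.ValiantsHypothesis.Theorems.DefinabilityGapPivotAdmissible
import Literature.Probability.Moments.BennettBernstein
import HarnessLib

/-!
# Definability gap, ROAD P: random row assignments — the Bernstein dictionary (N1 plan v2 (b))

Step (b) of the existence proof for few-bad loadable row assignments (NODE-v7 §H, lens-5 g7):
the row assignment `r : curve ↦ pivot row` is drawn from a PRODUCT law
`prodWeight w r = ∏_c w c (r c)` (`Literature.Probability.Moments.prodWeight`), and the number of
killed cells on a line of a curve's minor is dominated by a sum of independent bounded summands,
to which Bernstein's inequality in the tree's weighted finite form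
(`Literature.Probability.Moments.bernstein`) applies verbatim.

* `rowOverlap c c' i` — the number of cells of row `i` at which `c'` coincides with `c`
  (`≤ 2` for `c' ≠ c`, `rowOverlap_le_two`); `rowKill T c i c' a` — the kills that `c'`
  inflicts on row `i` of `S_c` when it pivots in row `a` (`= rowOverlap` if `a = i`, else `0`);
* `card_deadCols_le_sum_rowKill` — DICTIONARY: the killed cells of row `i ≠ r c` of the minor of
  `c` under `pivotZeros T s₀ r` number at most `Σ_{c'} rowKill T c i c' (r c')`;
* `sum_mean_rowKill` — the mean of that sum under `prodWeight w` is
  `Σ_{c' ∈ T \ {c}} w c' i · rowOverlap c c' i`;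
* `weight_rowOverload_le` — **Bernstein for row loads**: the `prodWeight w`-weight of the
  assignments `r` whose row-`i` kill sum exceeds `μ + t` (`μ ≥` the mean, `v ≥` the second
  moment) is at most `exp(−t²/(2(v + 2t/3)))`;
* the column analogue `colKill`, `card_killedRows_le_sum_colKill`, `weight_colOverload_le`
  (summands `≤ 1`, tail `exp(−t²/(2(v + t/3)))`).
-/

namespace Summit.ValiantsHypothesis.ValiantsHypothesis.Theorems.DefinabilityGapPivotRandom

open Finset Real
open Literature.Computability.AlgebraicComplexity Literature.Computability.MetaComplexity
open Literature.Probability.Moments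
open Summit.ValiantsHypothesis.ValiantsHypothesis.Theorems.DefinabilityGapAffineRung
open Summit.ValiantsHypothesis.ValiantsHypothesis.Theorems.DefinabilityGapPivotCertificate
open Summit.ValiantsHypothesis.ValiantsHypothesis.Theorems.DefinabilityGapPivotLive
open Summit.ValiantsHypothesis.ValiantsHypothesis.Theorems.DefinabilityGapPivotAdmissible

variable {m : ℕ}

/-! ## Rows -/

/-- The number of cells of row `i` at which the blocks of `c'` and `c` carry the same variable.
[lens-5 g7] -/
noncomputable def rowOverlap (c c' : Fin 3 → Fin (qOf m)) (i : Fin m) : ℕ :=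
  ((Finset.univ : Finset (Fin m)).filter fun j => cellEmb m c' (i, j) = cellEmb m c (i, j)).card

/-- Distinct blocks coincide in at most two cells of any row. [lens-5 g7] -/
theorem rowOverlap_le_two {c c' : Fin 3 → Fin (qOf m)} (hcc' : c' ≠ c) (i : Fin m) :
    rowOverlap c c' i ≤ 2 :=
  card_filter_cellEmb_eq_le hcc' i

/-- The kills inflicted by `c'` on row `i` of `S_c` when `c'` pivots in row `a`: `rowOverlap`
if `c' ∈ T`, `c' ≠ c` and `a = i`, else `0`. [lens-5 g7] -/
noncomputable def rowKill (T : Finset (Fin 3 → Fin (qOf m))) (c : Fin 3 → Fin (qOf m))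
    (i : Fin m) (c' : Fin 3 → Fin (qOf m)) (a : Fin m) : ℝ :=
  if c' ∈ T ∧ c' ≠ c ∧ a = i then (rowOverlap c c' i : ℝ) else 0

/-- `0 ≤ rowKill`. [lens-5 g7] -/
theorem rowKill_nonneg (T : Finset (Fin 3 → Fin (qOf m))) (c : Fin 3 → Fin (qOf m)) (i : Fin m)
    (c' : Fin 3 → Fin (qOf m)) (a : Fin m) : 0 ≤ rowKill T c i c' a := by
  unfold rowKill
  split_ifs <;> positivity

/-- `rowKill ≤ 2`. [lens-5 g7] -/
theorem rowKill_le_two (T : Finset (Fin 3 → Fin (qOf m))) (c : Fin 3 → Fin (qOf m)) (i : Fin m)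
    (c' : Fin 3 → Fin (qOf m)) (a : Fin m) : rowKill T c i c' a ≤ 2 := by
  unfold rowKill
  split_ifs with h
  · exact_mod_cast rowOverlap_le_two h.2.1 i
  · norm_num

/-- **Dictionary (rows)**: the killed cells of row `i ≠ r c` of the minor of `c` number at most
the kill sum `Σ_{c'} rowKill T c i c' (r c')`. [lens-5 g7] -/
theorem card_deadCols_le_sum_rowKill (T : Finset (Fin 3 → Fin (qOf m))) (s₀ : Fin m)
    (r : (Fin 3 → Fin (qOf m)) → Fin m) (c : Fin 3 → Fin (qOf m)) {i : Fin m}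
    (hi : i ≠ r c) :
    ((deadCols (pivotZeros m T s₀ r) c s₀ i).card : ℝ) ≤
      ∑ c' : Fin 3 → Fin (qOf m), rowKill T c i c' (r c') := by
  classical
  set R := (Finset.univ : Finset (Fin 3 → Fin (qOf m))).filter
    fun c' => c' ∈ T ∧ c' ≠ c ∧ r c' = i with hR
  have hsub : deadCols (pivotZeros m T s₀ r) c s₀ i ⊆
      R.biUnion fun c' => Finset.univ.filter fun j => cellEmb m c' (i, j) = cellEmb m c (i, j) := by
    intro j hj
    rw [mem_deadCols] at hj
    obtain ⟨c', hc'T, hc'c, hrc', heq⟩ := exists_of_mem_pivotZeros hi hj.2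
    exact Finset.mem_biUnion.mpr
      ⟨c', Finset.mem_filter.mpr ⟨Finset.mem_univ _, hc'T, hc'c, hrc'⟩,
        Finset.mem_filter.mpr ⟨Finset.mem_univ _, heq⟩⟩
  have h1 : (deadCols (pivotZeros m T s₀ r) c s₀ i).card ≤ ∑ c' ∈ R, rowOverlap c c' i :=
    (Finset.card_le_card hsub).trans Finset.card_biUnion_le
  have h2 : ((∑ c' ∈ R, rowOverlap c c' i : ℕ) : ℝ) =
      ∑ c' : Fin 3 → Fin (qOf m), rowKill T c i c' (r c') := by
    rw [hR, Finset.sum_filter, Nat.cast_sum]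
    refine Finset.sum_congr rfl fun c' _ => ?_
    unfold rowKill
    split_ifs <;> simp
  calc ((deadCols (pivotZeros m T s₀ r) c s₀ i).card : ℝ)
      ≤ ((∑ c' ∈ R, rowOverlap c c' i : ℕ) : ℝ) := by exact_mod_cast h1
    _ = _ := h2

/-- **Mean of the row kill sum** under a product law `w`:
`Σ_{c'} Σ_a w c' a · rowKill T c i c' a = Σ_{c' ∈ T \ {c}} w c' i · rowOverlap c c' i`.
[lens-5 g7] -/
theorem sum_mean_rowKill (w : (Fin 3 → Fin (qOf m)) → Fin m → ℝ)
    (T : Finset (Fin 3 → Fin (qOf m))) (c : Fin 3 → Fin (qOf m)) (i : Fin m) :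
    ∑ c' : Fin 3 → Fin (qOf m), ∑ a : Fin m, w c' a * rowKill T c i c' a =
      ∑ c' ∈ T.erase c, w c' i * rowOverlap c c' i := by
  classical
  have hin : ∀ c' : Fin 3 → Fin (qOf m), ∑ a : Fin m, w c' a * rowKill T c i c' a =
      if c' ∈ T ∧ c' ≠ c then w c' i * rowOverlap c c' i else 0 := by
    intro c'
    by_cases h : c' ∈ T ∧ c' ≠ c
    · rw [if_pos h, Finset.sum_eq_single i]
      · simp [rowKill, h]
      · intro a _ ha
        simp [rowKill, ha]
      · simp
    · rw [if_neg h]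
      refine Finset.sum_eq_zero fun a _ => ?_
      have : rowKill T c i c' a = 0 := by
        unfold rowKill
        rw [if_neg fun h' => h ⟨h'.1, h'.2.1⟩]
      simp [this]
  rw [Finset.sum_congr rfl fun c' _ => hin c', ← Finset.sum_filter]
  refine Finset.sum_congr ?_ fun _ _ => rfl
  ext c'
  simp [Finset.mem_erase, and_comm]

/-- **Bernstein for row loads.** Under a product law `w` on row assignments, if the mean of the
row-`i` kill sum of `c` is `≤ μ` and its second moment `≤ v`, then the assignments whose kill
sum reaches `μ + t` have weight `≤ exp(−t²/(2(v + 2t/3)))`.  With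
`card_deadCols_le_sum_rowKill` this bounds the probability that row `i` of the minor of `c`
loses `≥ μ + t` cells. [lens-5 g7] -/
theorem weight_rowOverload_le {w : (Fin 3 → Fin (qOf m)) → Fin m → ℝ}
    (hw : ∀ c a, 0 ≤ w c a) (hw1 : ∀ c, ∑ a, w c a = 1) (T : Finset (Fin 3 → Fin (qOf m)))
    (c : Fin 3 → Fin (qOf m)) (i : Fin m) {μ v t : ℝ}
    (hμ : ∑ c' : Fin 3 → Fin (qOf m), ∑ a : Fin m, w c' a * rowKill T c i c' a ≤ μ)
    (hv : 0 < v)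
    (hvv : ∑ c' : Fin 3 → Fin (qOf m), ∑ a : Fin m, w c' a * rowKill T c i c' a ^ 2 ≤ v)
    (ht : 0 < t) :
    ∑ r ∈ (Finset.univ : Finset ((Fin 3 → Fin (qOf m)) → Fin m)).filter
        (fun r => μ + t ≤ ∑ c', rowKill T c i c' (r c')), prodWeight w r
      ≤ exp (-(t ^ 2 / (2 * (v + 2 * t / 3)))) := by
  classical
  have hB := bernstein (ι := Fin 3 → Fin (qOf m)) (Γ := Fin m) hw hw1 (rowKill T c i)
    (b := 2) two_pos (fun c' a => rowKill_le_two T c i c' a) hv hvv ht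
  refine le_trans (Finset.sum_le_sum_of_subset_of_nonneg ?_ fun r _ _ => prodWeight_nonneg hw r) hB
  intro r hr
  rw [Finset.mem_filter] at hr ⊢
  refine ⟨Finset.mem_univ _, ?_⟩
  rw [Finset.sum_sub_distrib]
  linarith [hr.2]

/-- The second moment of the row kill sum is at most twice its mean (summands in `[0, 2]`), so
`v = 2μ` is admissible in `weight_rowOverload_le`. [lens-5 g7] -/
theorem sum_sq_rowKill_le (w : (Fin 3 → Fin (qOf m)) → Fin m → ℝ)
    (hw : ∀ c a, 0 ≤ w c a) (T : Finset (Fin 3 → Fin (qOf m))) (c : Fin 3 → Fin (qOf m))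
    (i : Fin m) :
    ∑ c' : Fin 3 → Fin (qOf m), ∑ a : Fin m, w c' a * rowKill T c i c' a ^ 2 ≤
      2 * ∑ c' : Fin 3 → Fin (qOf m), ∑ a : Fin m, w c' a * rowKill T c i c' a := by
  rw [Finset.mul_sum]
  refine Finset.sum_le_sum fun c' _ => ?_
  rw [Finset.mul_sum]
  refine Finset.sum_le_sum fun a _ => ?_
  have h0 := rowKill_nonneg T c i c' a
  have h2 := rowKill_le_two T c i c' a
  have hwa := hw c' a
  nlinarith [mul_nonneg hwa h0]

/-! ## Columns -/

/-- The kill inflicted by `c'` on the cell `(a, j)` of column `j` of `S_c` when `c'` pivots in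
row `a`: `1` if `c' ∈ T`, `c' ≠ c` and the blocks coincide at `(a, j)`, else `0`. [lens-5 g7] -/
noncomputable def colKill (T : Finset (Fin 3 → Fin (qOf m))) (c : Fin 3 → Fin (qOf m))
    (j : Fin m) (c' : Fin 3 → Fin (qOf m)) (a : Fin m) : ℝ :=
  if c' ∈ T ∧ c' ≠ c ∧ cellEmb m c' (a, j) = cellEmb m c (a, j) then 1 else 0

/-- `0 ≤ colKill`. [lens-5 g7] -/
theorem colKill_nonneg (T : Finset (Fin 3 → Fin (qOf m))) (c : Fin 3 → Fin (qOf m)) (j : Fin m)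
    (c' : Fin 3 → Fin (qOf m)) (a : Fin m) : 0 ≤ colKill T c j c' a := by
  unfold colKill
  split_ifs <;> norm_num

/-- `colKill ≤ 1`. [lens-5 g7] -/
theorem colKill_le_one (T : Finset (Fin 3 → Fin (qOf m))) (c : Fin 3 → Fin (qOf m)) (j : Fin m)
    (c' : Fin 3 → Fin (qOf m)) (a : Fin m) : colKill T c j c' a ≤ 1 := by
  unfold colKill
  split_ifs <;> norm_num

/-- **Dictionary (columns)**: the killed cells of column `j` of the minor of `c` (rows `≠ r c`)
number at most the kill sum `Σ_{c'} colKill T c j c' (r c')`. [lens-5 g7] -/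
theorem card_killedRows_le_sum_colKill (T : Finset (Fin 3 → Fin (qOf m))) (s₀ : Fin m)
    (r : (Fin 3 → Fin (qOf m)) → Fin m) (c : Fin 3 → Fin (qOf m)) (j : Fin m) :
    (((Finset.univ : Finset (Fin m)).filter
        fun i => i ≠ r c ∧ cellEmb m c (i, j) ∈ pivotZeros m T s₀ r).card : ℝ) ≤
      ∑ c' : Fin 3 → Fin (qOf m), colKill T c j c' (r c') := by
  classical
  set D := (Finset.univ : Finset (Fin m)).filter
    fun i => i ≠ r c ∧ cellEmb m c (i, j) ∈ pivotZeros m T s₀ r with hD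
  set R := (Finset.univ : Finset (Fin 3 → Fin (qOf m))).filter
    fun c' => c' ∈ T ∧ c' ≠ c ∧ cellEmb m c' (r c', j) = cellEmb m c (r c', j) with hR
  -- the map `i ↦ its killer` is injective from `D` into `R` (a killer pivots in row `i`)
  have hcard : D.card ≤ R.card := by
    have key : ∀ i ∈ D, ∃ c' ∈ R, r c' = i := by
      intro i hi
      rw [hD, Finset.mem_filter] at hi
      obtain ⟨c', hc'T, hc'c, hrc', heq⟩ := exists_of_mem_pivotZeros hi.2.1 hi.2.2
      refine ⟨c', Finset.mem_filter.mpr ⟨Finset.mem_univ _, hc'T, hc'c, ?_⟩, hrc'⟩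
      rw [hrc']
      exact heq
    calc D.card ≤ (R.image r).card := Finset.card_le_card fun i hi => by
            obtain ⟨c', hc', hrc'⟩ := key i hi
            exact Finset.mem_image.mpr ⟨c', hc', hrc'⟩
      _ ≤ R.card := Finset.card_image_le
  have h2 : (R.card : ℝ) = ∑ c' : Fin 3 → Fin (qOf m), colKill T c j c' (r c') := by
    rw [hR, Finset.card_filter, Nat.cast_sum]
    refine Finset.sum_congr rfl fun c' _ => ?_
    unfold colKill
    split_ifs <;> simp
  calc (D.card : ℝ) ≤ (R.card : ℝ) := by exact_mod_cast hcard
    _ = _ := h2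

/-- **Bernstein for column loads.** Under a product law `w`, if the mean of the column-`j` kill
sum of `c` is `≤ μ` and its second moment `≤ v`, the assignments whose kill sum reaches
`μ + t` have weight `≤ exp(−t²/(2(v + t/3)))`. [lens-5 g7] -/
theorem weight_colOverload_le {w : (Fin 3 → Fin (qOf m)) → Fin m → ℝ}
    (hw : ∀ c a, 0 ≤ w c a) (hw1 : ∀ c, ∑ a, w c a = 1) (T : Finset (Fin 3 → Fin (qOf m)))
    (c : Fin 3 → Fin (qOf m)) (j : Fin m) {μ v t : ℝ}
    (hμ : ∑ c' : Fin 3 → Fin (qOf m), ∑ a : Fin m, w c' a * colKill T c j c' a ≤ μ)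
    (hv : 0 < v)
    (hvv : ∑ c' : Fin 3 → Fin (qOf m), ∑ a : Fin m, w c' a * colKill T c j c' a ^ 2 ≤ v)
    (ht : 0 < t) :
    ∑ r ∈ (Finset.univ : Finset ((Fin 3 → Fin (qOf m)) → Fin m)).filter
        (fun r => μ + t ≤ ∑ c', colKill T c j c' (r c')), prodWeight w r
      ≤ exp (-(t ^ 2 / (2 * (v + 1 * t / 3)))) := by
  classical
  have hB := bernstein (ι := Fin 3 → Fin (qOf m)) (Γ := Fin m) hw hw1 (colKill T c j)
    (b := 1) one_pos (fun c' a => colKill_le_one T c j c' a) hv hvv ht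
  refine le_trans (Finset.sum_le_sum_of_subset_of_nonneg ?_ fun r _ _ => prodWeight_nonneg hw r) hB
  intro r hr
  rw [Finset.mem_filter] at hr ⊢
  refine ⟨Finset.mem_univ _, ?_⟩
  rw [Finset.sum_sub_distrib]
  linarith [hr.2]

/-- The second moment of the column kill sum is at most its mean (summands in `[0, 1]`).
[lens-5 g7] -/
theorem sum_sq_colKill_le (w : (Fin 3 → Fin (qOf m)) → Fin m → ℝ)
    (hw : ∀ c a, 0 ≤ w c a) (T : Finset (Fin 3 → Fin (qOf m))) (c : Fin 3 → Fin (qOf m))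
    (j : Fin m) :
    ∑ c' : Fin 3 → Fin (qOf m), ∑ a : Fin m, w c' a * colKill T c j c' a ^ 2 ≤
      ∑ c' : Fin 3 → Fin (qOf m), ∑ a : Fin m, w c' a * colKill T c j c' a := by
  refine Finset.sum_le_sum fun c' _ => Finset.sum_le_sum fun a _ => ?_
  have h0 := colKill_nonneg T c j c' a
  have h1 := colKill_le_one T c j c' a
  have hwa := hw c' a
  nlinarith [mul_nonneg hwa h0]

end Summit.ValiantsHypothesis.ValiantsHypothesis.Theorems.DefinabilityGapPivotRandom
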